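import Summits.QuantumFields.YangMills.Theorems.BalabanLadderUVSeamRecCeilingsBlockChessboard
import HarnessLib

/-!
# Crux `UVSeamRec` (stmt-QuantumFields-20043), stub `stub_ceilings` (E0′): the block chessboard WITHOUT the positivity
# hypothesis

Helper file (`--supports stmt-QuantumFields-20043`) of the stub seat `ym-20043-seam-s2`; sibling of
`BalabanLadderUVSeamRecCeilingsBlockChessboard.lean` (`measureReal_biInter_blocks_le_rpow`: for a covariant family of block
cylinder events on the Wilson torus of side `M = N·w`, `N` even, `μ(⋂_{c∈S} Bad c) ≤ μ(⋂_c Bad c)^{#S/N^d}` provided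
`μ(⋂_c Bad c) > 0`).  Here the positivity hypothesis is removed by the `ε`-regularisation `1_{Bad c} + ε` (as in the tree's
`PlaquetteChessboard.integral_plaquette_le_rpow_all`): `integral_prod_indicator_add_le_rpow` (the engine call for the
regularised family) and `measureReal_biInter_blocks_le_rpow'` (every non-empty `S`, no positivity hypothesis) — so the
tiling rarity `μ(⋂_{k∈A} B k) ≤ δ₀^{#A}` consumed by `DefectCollar.measureReal_biInter_le_of_cover` holds with
`δ₀ = μ(⋂_c Bad c)^{1/N^d}` unconditionally (`measureReal_biInter_blocks_le_pow`, every `S`; `universalConstant_mem_Icc`).  HONEST FRAMING: FILS bookkeeping; the universal constant `δ₀` (a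
large-field estimate on the family torus) is OPEN; not E0′, not a gap.

References: J. Fröhlich, R. Israel, E. H. Lieb, B. Simon, Commun. Math. Phys. 62 (1978) Thm. 4.1; K. Osterwalder,
E. Seiler, Ann. Phys. 110 (1978) §2.
-/

set_option autoImplicit false

noncomputable section

open MeasureTheory Filter Topology Finset
open Literature.Probability.LatticeModels Literature.Barriers.CriticalPhenomena.NonGibbs
open Literature.MathematicalPhysics.QuantumFieldTheory
open Literature.MathematicalPhysics.QuantumFieldTheory.WilsonRP
open Literature.MathematicalPhysics.QuantumFieldTheory.FariaDaVeigaOCarroll2022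
open Literature.MathematicalPhysics.QuantumFieldTheory.FariaDaVeigaOCarroll2022.MultiReflection
open Literature.MathematicalPhysics.QuantumFieldTheory.PlaquetteChessboard
open Literature.MathematicalPhysics.QuantumLattice (integrable_of_abs_le)

namespace Summit.QuantumFields.YangMills.Cruxes.UVSeamRec.DefectCollar

section Chessboard

variable {d M N w m : ℕ} [NeZero d] [NeZero M] [NeZero N]
variable {G : Type*} [Group G] [TopologicalSpace G] [IsTopologicalGroup G] [CompactSpace G]
  [MeasurableSpace G] [BorelSpace G]
variable (ρ : G →* Matrix (Fin m) (Fin m) ℂ)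

/-- **The ε-regularised block chessboard** (engine call for the observables `1_{Bad c} + ε`, `ε ≥ 0`): same hypotheses
as `measureReal_biInter_blocks_le_rpow` but with the positivity hypothesis on the regularised family, which is automatic
for `ε > 0`.  Used to remove the positivity hypothesis. [cite: FrohlichIsraelLiebSimon1978, Thm. 4.1] -/
theorem integral_prod_indicator_add_le_rpow (hM : M = N * w) (hN : Even N) (hw : 1 ≤ w) (hρ : Continuous ρ)
    {β : ℝ} (hβ : 0 ≤ β) (Bad : BlockIdx d N → Set (GaugeConfig d M G)) (hBm : ∀ c, MeasurableSet (Bad c))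
    (hBdep : ∀ c (U V : GaugeConfig d M G),
      (∀ e : Edge d M, (∀ j, (c j).val * w ≤ (e.1 j).val ∧ (e.1 j).val < (c j).val * w + w) →
        (∀ j, (c j).val * w ≤ ((e.1.shift e.2) j).val ∧ ((e.1.shift e.2) j).val < (c j).val * w + w) →
        U e = V e) → (U ∈ Bad c ↔ V ∈ Bad c))
    (hcov : ∀ (i : Fin d) (k : ZMod N) (c : BlockIdx d N) (U : GaugeConfig d M G),
      linkCellReflect i (((k.val * w : ℕ) : ZMod M)) U ∈ Bad c ↔ U ∈ Bad (cellReflect i k c))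
    {ε : ℝ} (hε : 0 ≤ ε)
    (hpos : 0 < ∫ U, ∏ c, ((Bad c).indicator (fun _ => (1 : ℝ)) U + ε) ∂(wilsonMeasure (d := d) (L := M) ρ β))
    (S : Finset (BlockIdx d N)) :
    ∫ U, ∏ c ∈ S, ((Bad c).indicator (fun _ => (1 : ℝ)) U + ε) ∂(wilsonMeasure (d := d) (L := M) ρ β) ≤
      (∫ U, ∏ c, ((Bad c).indicator (fun _ => (1 : ℝ)) U + ε) ∂(wilsonMeasure (d := d) (L := M) ρ β)) ^
        ((S.card : ℝ) / (N : ℝ) ^ d) := by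
  classical
  haveI := isProbabilityMeasure_wilsonMeasure (d := d) (L := M) ρ hρ β
  have hMe : Even M := by obtain ⟨n, hn⟩ := hN; exact ⟨n * w, by rw [hM, hn]; ring⟩
  set F : BlockIdx d N → GaugeConfig d M G → ℝ := fun c U => (Bad c).indicator (fun _ => (1 : ℝ)) U + ε
    with hFdef
  have hind0 : ∀ c U, 0 ≤ (Bad c).indicator (fun _ => (1 : ℝ)) U := fun c U =>
    Set.indicator_nonneg (fun _ _ => zero_le_one) _
  have hind1 : ∀ c U, (Bad c).indicator (fun _ => (1 : ℝ)) U ≤ 1 := fun c U =>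
    Set.indicator_apply_le' (fun _ => le_rfl) (fun _ => zero_le_one)
  have hFm : ∀ c, Measurable (F c) := fun c => (measurable_const.indicator (hBm c)).add_const ε
  have hFb : ∀ c, ∃ K : ℝ, ∀ U, |F c U| ≤ K := fun c => ⟨1 + ε, fun U => by
    simp only [hFdef]
    rw [abs_of_nonneg (add_nonneg (hind0 c U) hε)]
    exact add_le_add_left (hind1 c U) _⟩
  have hF0 : ∀ c U, 0 ≤ F c U := fun c U => add_nonneg (hind0 c U) hε
  exact chessboard_of_reflectionCS (μ := wilsonMeasure (d := d) (L := M) ρ β) hN F hFm hFb hF0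
    (fun i k => linkCellReflect i (((k.val * w : ℕ) : ZMod M)))
    (fun i k A => DependsOn (A ∘ cellSymm i ((((k.val * w : ℕ) : ZMod M)) - 1)) {e : Edge d M | IsPosEdge e})
    (fun i k A B hA hB U V hUV => by
      have h1 := hA hUV; have h2 := hB hUV
      simp only [Function.comp_apply] at h1 h2 ⊢; rw [h1, h2])
    (fun i k => fun _ _ _ => rfl)
    (fun i k c hc U V hUV => by
      simp only [Function.comp_apply, hFdef]
      have hiff : cellSymm i ((((k.val * w : ℕ) : ZMod M)) - 1) U ∈ Bad c ↔
          cellSymm i ((((k.val * w : ℕ) : ZMod M)) - 1) V ∈ Bad c := by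
        refine hBdep c _ _ fun e he1 he2 => ?_
        rw [cellSymm_apply_edge, cellSymm_apply_edge]
        exact hUV _ (isPosEdge_transport_of_mem_block hM hN hw hc (he1 i) (he2 i))
      by_cases hU : cellSymm i ((((k.val * w : ℕ) : ZMod M)) - 1) U ∈ Bad c
      · rw [Set.indicator_of_mem hU, Set.indicator_of_mem (hiff.1 hU)]
      · rw [Set.indicator_of_notMem hU, Set.indicator_of_notMem (fun h => hU (hiff.2 h))])
    (fun i k c U => by
      simp only [hFdef]
      by_cases hU : linkCellReflect i (((k.val * w : ℕ) : ZMod M)) U ∈ Bad c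
      · rw [Set.indicator_of_mem hU, Set.indicator_of_mem ((hcov i k c U).1 hU)]
      · rw [Set.indicator_of_notMem hU, Set.indicator_of_notMem (fun h => hU ((hcov i k c U).2 h))])
    (fun i k A B hA hB hAm hBm hAb hBb =>
      linkCellReflect_cauchySchwarz ρ hMe hρ hβ i _ hA hB hAm hBm hAb hBb)
    hpos S

/-- **THE BLOCK CHESSBOARD WITHOUT THE POSITIVITY HYPOTHESIS**: for a covariant family of block cylinder events,
`μ_{Λ,β}(⋂_{c∈S} Bad c) ≤ μ_{Λ,β}(⋂_c Bad c)^{#S/N^d}` for every NON-EMPTY set `S` of blocks — if `μ(⋂_c Bad c) = 0` the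
right-hand side is `0` and the bound follows from the `ε`-regularised chessboard as `ε ↓ 0`
(`∫ ∏_c (1_{Bad c} + ε) ≤ (μ(⋂_c Bad c) + ε)(1+ε)^{N^d}`).  So the tiling rarity consumed by
`measureReal_biInter_le_of_cover` holds with `δ₀ = μ(⋂_c Bad c)^{1/N^d}`. [cite: FrohlichIsraelLiebSimon1978, Thm. 4.1] -/
theorem measureReal_biInter_blocks_le_rpow' (hM : M = N * w) (hN : Even N) (hw : 1 ≤ w) (hρ : Continuous ρ)
    {β : ℝ} (hβ : 0 ≤ β) (Bad : BlockIdx d N → Set (GaugeConfig d M G)) (hBm : ∀ c, MeasurableSet (Bad c))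
    (hBdep : ∀ c (U V : GaugeConfig d M G),
      (∀ e : Edge d M, (∀ j, (c j).val * w ≤ (e.1 j).val ∧ (e.1 j).val < (c j).val * w + w) →
        (∀ j, (c j).val * w ≤ ((e.1.shift e.2) j).val ∧ ((e.1.shift e.2) j).val < (c j).val * w + w) →
        U e = V e) → (U ∈ Bad c ↔ V ∈ Bad c))
    (hcov : ∀ (i : Fin d) (k : ZMod N) (c : BlockIdx d N) (U : GaugeConfig d M G),
      linkCellReflect i (((k.val * w : ℕ) : ZMod M)) U ∈ Bad c ↔ U ∈ Bad (cellReflect i k c))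
    {S : Finset (BlockIdx d N)} (hS : S.Nonempty) :
    (wilsonMeasure (d := d) (L := M) ρ β).real (⋂ c ∈ S, Bad c) ≤
      ((wilsonMeasure (d := d) (L := M) ρ β).real (⋂ c, Bad c)) ^ ((S.card : ℝ) / (N : ℝ) ^ d) := by
  classical
  haveI := isProbabilityMeasure_wilsonMeasure (d := d) (L := M) ρ hρ β
  set μ := wilsonMeasure (d := d) (L := M) ρ β with hμ
  have hN0 : 0 < N := Nat.pos_of_ne_zero (NeZero.ne N)
  have hq : 0 < (S.card : ℝ) / (N : ℝ) ^ d := by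
    have : 0 < S.card := Finset.card_pos.2 hS
    have : (0 : ℝ) < (N : ℝ) ^ d := by positivity
    positivity
  rcases (measureReal_nonneg : 0 ≤ μ.real (⋂ c, Bad c)).lt_or_eq with hpos | hnull
  · exact measureReal_biInter_blocks_le_rpow ρ hM hN hw hρ hβ Bad hBm hBdep hcov hpos S
  -- the null case: `ε`-regularisation
  rw [← hnull, Real.zero_rpow hq.ne']
  set n : ℕ := Fintype.card (BlockIdx d N) with hn
  set χ : BlockIdx d N → GaugeConfig d M G → ℝ := fun c U => (Bad c).indicator (fun _ => (1 : ℝ)) U with hχ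
  have hχ0 : ∀ c U, 0 ≤ χ c U := fun c U => Set.indicator_nonneg (fun _ _ => zero_le_one) _
  have hχ1 : ∀ c U, χ c U ≤ 1 := fun c U => Set.indicator_apply_le' (fun _ => le_rfl) (fun _ => zero_le_one)
  have hχm : ∀ c, Measurable (χ c) := fun c => measurable_const.indicator (hBm c)
  -- pointwise: `∏_c (χ c + ε) ≤ (∏_c χ c + ε)(1+ε)^n`
  have hpt : ∀ {ε : ℝ}, 0 ≤ ε → ∀ U, ∏ c, (χ c U + ε) ≤ (∏ c, χ c U + ε) * (1 + ε) ^ n := by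
    intro ε hε U
    have hfac : ∀ c, χ c U + ε ≤ 1 + ε := fun c => add_le_add_left (hχ1 c U) _
    have hfac0 : ∀ c, 0 ≤ χ c U + ε := fun c => add_nonneg (hχ0 c U) hε
    have hall : ∏ c, (χ c U + ε) ≤ (1 + ε) ^ n := by
      calc ∏ c, (χ c U + ε) ≤ ∏ _c : BlockIdx d N, (1 + ε) :=
            Finset.prod_le_prod (fun c _ => hfac0 c) fun c _ => hfac c
        _ = (1 + ε) ^ n := by rw [Finset.prod_const, Finset.card_univ]
    have hprod0 : 0 ≤ ∏ c, χ c U := Finset.prod_nonneg fun c _ => hχ0 c U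
    by_cases h : ∀ c, U ∈ Bad c
    · have h1 : ∏ c, χ c U = 1 := Finset.prod_eq_one fun c _ => by
        simp only [hχ]; exact Set.indicator_of_mem (h c) _
      rw [h1]
      calc ∏ c, (χ c U + ε) ≤ (1 + ε) ^ n := hall
        _ ≤ (1 + ε) * (1 + ε) ^ n := le_mul_of_one_le_left (by positivity) (by linarith)
    · obtain ⟨c₀, hc₀⟩ := not_forall.1 h
      have hz : χ c₀ U = 0 := by simp only [hχ]; exact Set.indicator_of_notMem hc₀ _
      rw [← Finset.mul_prod_erase Finset.univ (fun c => χ c U + ε) (Finset.mem_univ c₀), hz, zero_add]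
      have hrest : ∏ c ∈ Finset.univ.erase c₀, (χ c U + ε) ≤ (1 + ε) ^ n := by
        calc ∏ c ∈ Finset.univ.erase c₀, (χ c U + ε) ≤ ∏ _c ∈ Finset.univ.erase c₀, (1 + ε) :=
              Finset.prod_le_prod (fun c _ => hfac0 c) fun c _ => hfac c
          _ = (1 + ε) ^ (Finset.univ.erase c₀).card := Finset.prod_const _
          _ ≤ (1 + ε) ^ n := pow_le_pow_right₀ (by linarith) (by
              rw [hn, ← Finset.card_univ]; exact Finset.card_erase_le)
      calc ε * ∏ c ∈ Finset.univ.erase c₀, (χ c U + ε) ≤ ε * (1 + ε) ^ n :=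
            mul_le_mul_of_nonneg_left hrest hε
        _ ≤ (∏ c, χ c U + ε) * (1 + ε) ^ n :=
            mul_le_mul_of_nonneg_right (le_add_of_nonneg_left hprod0) (by positivity)
  -- for `ε > 0`: `μ(⋂_S) ≤ (ε (1+ε)^n)^q`
  have hbound : ∀ ε : ℝ, 0 < ε →
      μ.real (⋂ c ∈ S, Bad c) ≤ (ε * (1 + ε) ^ n) ^ ((S.card : ℝ) / (N : ℝ) ^ d) := by
    intro ε hε
    have hintS : Integrable (fun U => ∏ c ∈ S, (χ c U + ε)) μ :=
      integrable_of_abs_le (Finset.measurable_prod _ fun c _ => (hχm c).add_const ε) (C := (1 + ε) ^ S.card)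
        (fun U => by
          rw [Finset.abs_prod]
          calc ∏ c ∈ S, |χ c U + ε| ≤ ∏ _c ∈ S, (1 + ε) := Finset.prod_le_prod (fun c _ => abs_nonneg _)
                fun c _ => by rw [abs_of_nonneg (add_nonneg (hχ0 c U) hε.le)]; exact add_le_add_left (hχ1 c U) _
            _ = (1 + ε) ^ S.card := Finset.prod_const _)
    have hintU : Integrable (fun U => ∏ c, (χ c U + ε)) μ :=
      integrable_of_abs_le (Finset.measurable_prod _ fun c _ => (hχm c).add_const ε) (C := (1 + ε) ^ n)
        (fun U => by
          rw [Finset.abs_prod]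
          calc ∏ c, |χ c U + ε| ≤ ∏ _c : BlockIdx d N, (1 + ε) := Finset.prod_le_prod (fun c _ => abs_nonneg _)
                fun c _ => by rw [abs_of_nonneg (add_nonneg (hχ0 c U) hε.le)]; exact add_le_add_left (hχ1 c U) _
            _ = (1 + ε) ^ n := by rw [Finset.prod_const, Finset.card_univ])
    -- positivity of the regularised universal integral
    have hposε : 0 < ∫ U, ∏ c, (χ c U + ε) ∂μ := by
      have hlow : ∀ U, ε ^ n ≤ ∏ c, (χ c U + ε) := fun U => by
        calc ε ^ n = ∏ _c : BlockIdx d N, ε := by rw [Finset.prod_const, Finset.card_univ]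
          _ ≤ ∏ c, (χ c U + ε) := Finset.prod_le_prod (fun c _ => hε.le) fun c _ => le_add_of_nonneg_left (hχ0 c U)
      calc (0 : ℝ) < ε ^ n := pow_pos hε n
        _ = ∫ _U, ε ^ n ∂μ := by simp
        _ ≤ ∫ U, ∏ c, (χ c U + ε) ∂μ := integral_mono (integrable_const _) hintU hlow
    have key := integral_prod_indicator_add_le_rpow ρ hM hN hw hρ hβ Bad hBm hBdep hcov hε.le hposε S
    -- lower bound of the left side by the measure
    have hL : μ.real (⋂ c ∈ S, Bad c) ≤ ∫ U, ∏ c ∈ S, (χ c U + ε) ∂μ := by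
      rw [← integral_prod_indicator_eq_measureReal μ S Bad hBm]
      refine integral_mono_of_nonneg (ae_of_all _ fun U => Finset.prod_nonneg fun c _ => hχ0 c U) hintS
        (ae_of_all _ fun U => Finset.prod_le_prod (fun c _ => hχ0 c U) fun c _ => le_add_of_nonneg_right hε.le)
    -- upper bound of the right side
    have hintχ : Integrable (fun U => ∏ c, χ c U) μ :=
      integrable_of_abs_le (Finset.measurable_prod _ fun c _ => hχm c) (C := 1) (fun U => by
        rw [Finset.abs_prod]
        calc ∏ c, |χ c U| ≤ ∏ _c : BlockIdx d N, (1 : ℝ) := Finset.prod_le_prod (fun c _ => abs_nonneg _)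
              fun c _ => by rw [abs_of_nonneg (hχ0 c U)]; exact hχ1 c U
          _ = 1 := by simp)
    have huniv' : ∫ U, ∏ c, χ c U ∂μ = μ.real (⋂ c, Bad c) := by
      have h := integral_prod_indicator_eq_measureReal μ Finset.univ Bad hBm
      have hset : (⋂ c ∈ (Finset.univ : Finset (BlockIdx d N)), Bad c) = ⋂ c, Bad c := by
        ext U; simp
      rw [hset] at h
      rw [← h]
    have hR : ∫ U, ∏ c, (χ c U + ε) ∂μ ≤ ε * (1 + ε) ^ n := by
      have hint1 : Integrable (fun U => (∏ c, χ c U + ε) * (1 + ε) ^ n) μ :=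
        (hintχ.add (integrable_const ε)).mul_const _
      calc ∫ U, ∏ c, (χ c U + ε) ∂μ ≤ ∫ U, (∏ c, χ c U + ε) * (1 + ε) ^ n ∂μ :=
            integral_mono hintU hint1 (hpt hε.le)
        _ = (μ.real (⋂ c, Bad c) + ε) * (1 + ε) ^ n := by
            rw [integral_mul_const, integral_add hintχ (integrable_const ε), integral_const, huniv',
              probReal_univ, one_smul]
        _ = ε * (1 + ε) ^ n := by rw [← hnull, zero_add]
    calc μ.real (⋂ c ∈ S, Bad c) ≤ ∫ U, ∏ c ∈ S, (χ c U + ε) ∂μ := hL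
      _ ≤ (∫ U, ∏ c, (χ c U + ε) ∂μ) ^ ((S.card : ℝ) / (N : ℝ) ^ d) := key
      _ ≤ (ε * (1 + ε) ^ n) ^ ((S.card : ℝ) / (N : ℝ) ^ d) :=
          Real.rpow_le_rpow (integral_nonneg fun U => Finset.prod_nonneg fun c _ => add_nonneg (hχ0 c U) hε.le)
            hR hq.le
  -- let `ε ↓ 0`
  have hlim : Tendsto (fun ε : ℝ => (ε * (1 + ε) ^ n) ^ ((S.card : ℝ) / (N : ℝ) ^ d)) (𝓝[>] 0) (𝓝 0) := by
    have h1 : Tendsto (fun ε : ℝ => ε * (1 + ε) ^ n) (𝓝[>] 0) (𝓝 0) := by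
      have hc : Continuous fun ε : ℝ => ε * (1 + ε) ^ n := by fun_prop
      have h0 : Tendsto (fun ε : ℝ => ε * (1 + ε) ^ n) (𝓝 0) (𝓝 0) := by
        simpa using hc.tendsto 0
      exact h0.mono_left (nhdsWithin_le_nhds (s := Set.Ioi (0 : ℝ)))
    have h2 := h1.rpow_const (p := (S.card : ℝ) / (N : ℝ) ^ d) (Or.inr hq.le)
    rwa [Real.zero_rpow hq.ne'] at h2
  exact le_of_tendsto_of_tendsto tendsto_const_nhds hlim
    (eventually_nhdsWithin_of_forall fun ε hε => hbound ε hε)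

/-- **The block chessboard in the `δ₀ ^ #S` currency of the covering lemma.**  With the universal constant
`δ₀ := μ(⋂_c Bad c)^{1/N^d} ∈ [0, 1]`, every set of blocks `S` (empty or not) satisfies `μ_{Λ,β}(⋂_{c∈S} Bad c) ≤ δ₀ ^ #S` — exactly
the tiling-rarity hypothesis `hrare` of `DefectCollar.measureReal_biInter_le_of_cover` (and `0 ≤ δ₀ ≤ 1` for its `hδ₀`, `hδ₁`).
[cite: FrohlichIsraelLiebSimon1978, Thm. 4.1] -/
theorem measureReal_biInter_blocks_le_pow (hM : M = N * w) (hN : Even N) (hw : 1 ≤ w) (hρ : Continuous ρ)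
    {β : ℝ} (hβ : 0 ≤ β) (Bad : BlockIdx d N → Set (GaugeConfig d M G)) (hBm : ∀ c, MeasurableSet (Bad c))
    (hBdep : ∀ c (U V : GaugeConfig d M G),
      (∀ e : Edge d M, (∀ j, (c j).val * w ≤ (e.1 j).val ∧ (e.1 j).val < (c j).val * w + w) →
        (∀ j, (c j).val * w ≤ ((e.1.shift e.2) j).val ∧ ((e.1.shift e.2) j).val < (c j).val * w + w) →
        U e = V e) → (U ∈ Bad c ↔ V ∈ Bad c))
    (hcov : ∀ (i : Fin d) (k : ZMod N) (c : BlockIdx d N) (U : GaugeConfig d M G),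
      linkCellReflect i (((k.val * w : ℕ) : ZMod M)) U ∈ Bad c ↔ U ∈ Bad (cellReflect i k c))
    (S : Finset (BlockIdx d N)) :
    (wilsonMeasure (d := d) (L := M) ρ β).real (⋂ c ∈ S, Bad c) ≤
      (((wilsonMeasure (d := d) (L := M) ρ β).real (⋂ c, Bad c)) ^ ((1 : ℝ) / (N : ℝ) ^ d)) ^ S.card := by
  haveI := isProbabilityMeasure_wilsonMeasure (d := d) (L := M) ρ hρ β
  set μ := wilsonMeasure (d := d) (L := M) ρ β with hμ
  have hm0 : 0 ≤ μ.real (⋂ c, Bad c) := measureReal_nonneg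
  rcases S.eq_empty_or_nonempty with rfl | hS
  · simp
  · have h := measureReal_biInter_blocks_le_rpow' ρ hM hN hw hρ hβ Bad hBm hBdep hcov hS
    rw [← Real.rpow_natCast, ← Real.rpow_mul hm0]
    convert h using 2
    have hN0 : (N : ℝ) ^ d ≠ 0 := by
      have : (N : ℝ) ≠ 0 := by exact_mod_cast NeZero.ne N
      positivity
    field_simp

omit [NeZero d] [NeZero N] in
/-- The universal constant `δ₀ = μ(⋂_c Bad c)^{1/N^d}` lies in `[0, 1]`. [folklore] -/
theorem universalConstant_mem_Icc (β : ℝ) (hρ : Continuous ρ) (Bad : BlockIdx d N → Set (GaugeConfig d M G)) :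
    0 ≤ ((wilsonMeasure (d := d) (L := M) ρ β).real (⋂ c, Bad c)) ^ ((1 : ℝ) / (N : ℝ) ^ d) ∧
      ((wilsonMeasure (d := d) (L := M) ρ β).real (⋂ c, Bad c)) ^ ((1 : ℝ) / (N : ℝ) ^ d) ≤ 1 := by
  haveI := isProbabilityMeasure_wilsonMeasure (d := d) (L := M) ρ hρ β
  exact ⟨Real.rpow_nonneg measureReal_nonneg _,
    Real.rpow_le_one measureReal_nonneg measureReal_le_one (by positivity)⟩

end Chessboard

end Summit.QuantumFields.YangMills.Cruxes.UVSeamRec.DefectCollar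

end
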